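import Mathlib
import Summits.CriticalPhenomena.CardyFormulaZ2.Theorems.CardyFlipRussoSquareFromVoronoiHubDefs
import Summits.CriticalPhenomena.CardyFormulaZ2.Theorems.CardyFlipRussoSquareFromVoronoiHubChessboardDefs
import Summits.CriticalPhenomena.CardyFormulaZ2.Theorems.CardyFlipRussoSquareFromVoronoiHubChessboardTiling
import Summits.CriticalPhenomena.CardyFormulaZ2.Theorems.CardyFlipRussoSquareFromVoronoiHubChessboardEndpointPart1
import Summits.CriticalPhenomena.CardyFormulaZ2.Theorems.CardyFlipRussoSquareFromVoronoiHubFaithfulDefs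
import Summits.CriticalPhenomena.CardyFormulaZ2.Theorems.CardyFlipRussoSquareFromVoronoiHubFaithfulPart4
import Summits.CriticalPhenomena.CardyFormulaZ2.Theorems.CardyFlipRussoSquareFromVoronoiHubFaithfulPart7
import Summits.CriticalPhenomena.CardyFormulaZ2.Theorems.CardyFlipRussoSquareFromVoronoiHubPerturbedRectangles
import Literature.Probability.Percolation.VoronoiCrossing
import Literature.Probability.Percolation.SitePaths
import Literature.Analysis.FunctionSpaces.PoissonPointProcess
import Literature.Analysis.FunctionSpaces.PoissonPointProcessExistence
import HarnessLib

/-!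
# Stub `stub_endpointSandwich_of` (S7) of line `Sketch` (r2 k4, card `poissonised-chessboard`):
# the chessboard endpoint — the `u = 1` end of the leg IS site percolation on `G_s`

Crux `Summit.CriticalPhenomena.CardyFormulaZ2.Theses.CardyFlipRusso.SquareFromVoronoiHub`
(stmt-CriticalPhenomena-6434), line `Sketch` (round 2, card `poissonised-chessboard`), registered stub
`stub_endpointSandwich_of` (S7, the lead's stub), proved here under its registered name from the three
registered statements it consumes as hypotheses — the lower inclusion (S4, landed as
`stub_lowerCrossing`), the upper exclusion (S5, `stub_upperExclusion`), the density estimate (S6,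
`stub_densityWhp`) — together with the landed helper `stub_tiling` (metric facts of the cut-corner
`4.8.8` partition `blkUnit`), the perturbed conformal rectangles of K1 (`stub_perturbedRectangles`, S1
of line voronoi-blocks: caps/collars specs `lowerMargins` / `upperMargins`, Cardy values within `θ`),
and Part 1 (`…ChessboardEndpointPart1`: measurability of `crudeCrossing`, the coin marginal, the
colour-flip duality `legMeasure_real_whiteCrossing`, the plane-nuclei dictionary).

* `sandwich_at` — **the sandwich at a fixed small mesh** `δ`: for the `u = 1` leg law
  `μ = legMeasure P P PK` (free intensities `0`, equal free laws) and margins `r > δ`, `r ≥ 2δ` of the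
  perturbed rectangles `R₁`, `R₂` of `R`,
  `legProb R₁ − μ(bad) ≤ siteCrossingProb R δ ≤ 1 − legProb R₂ + μ(bad)`,
  where `bad` is the complement of the good event of S6 on the window
  `V = cthickening 1 (closure Ω ∪ closure R₁ ∪ closure R₂)`.  Deterministic inclusions: on the good
  event a black continuum crossing of `R₁` gives the crude coin crossing of `R` (S4 with the block map
  `β p = blkUnit (p/δ)`), and the crude coin crossing of `R` excludes a white continuum crossing of `R₂`
  (S5); then outer-measure bookkeeping against the MEASURABLE coin event (`measureReal_inter_add_sdiff`,
  `probReal_compl_eq_one_sub`), the coin marginal being `sitePercolation _ half` and the white crossing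
  probability being `legProb` by the colour flip.
* `stub_endpointSandwich_of` — **the endpoint**: the `u = 1` laws exist
  (`existsUnique_isPoissonPointProcess_holds` for the intensities `0` and `2 · volume`); given `θ > 0`,
  eventually in `δ → 0⁺` the sandwich holds, `μ(bad) ≤ θ` (S6) and the leg probabilities of `R₁`, `R₂`
  are within `θ` of their Cardy limits (hypothesis at `u = 1`), which are within `θ` of `F(η_R)` and
  `1 − F(η_R)`; hence `|siteCrossingProb R δ − F(η_R)| ≤ 3θ` eventually.

Sources: Bollobás–Riordan, *Percolation* (2006), Ch. 7 (19) with Lemma 14 (sandwich by perturbed marked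
domains), Ch. 8 §8.1–8.3 (two-coloured Voronoi tessellations, duality, fine discretisations).
-/

noncomputable section

open scoped Topology Pointwise
open Filter Set MeasureTheory Metric
open UpperHalfPlane (upperHalfPlaneSet)
open Literature.Analysis.FunctionSpaces (PointConfig IsPoissonPointProcess)
open Literature.Probability.RandomPlanarGeometry (ConformalRectangle ConformalEquiv cardyFunction
  crossRatio)
open Literature.Probability.Percolation (SiteConfig sitePercolation half voronoiCrossing blackRegion PathIn)
open Summit.CriticalPhenomena.CardyFormulaZ2.Cruxes.SquareFromVoronoiHub.VoronoiBlocks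
  (zGs Gs crudeCrossing siteCrossingProb voronoiCrossingProb squareFromVoronoiHub_iff)
open Summit.CriticalPhenomena.CardyFormulaZ2.Cruxes.SquareFromVoronoiHub.VoronoiBlocks.Faithful
  (lowerMargins upperMargins stub_perturbedRectangles exists_path_of_voronoiCrossing
    eventually_lt_infDist_arc_two)

namespace Summit.CriticalPhenomena.CardyFormulaZ2.Cruxes.SquareFromVoronoiHub.PoissonisedChessboard

/-! ### The sandwich at a fixed mesh -/

/-- **The sandwich at a fixed small mesh `δ`.**  Let `μ = legMeasure P P PK` with probability laws
(the `u = 1` leg law has equal — in fact trivial — free laws), `R₁`, `R₂` perturbed rectangles of `R`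
with caps/collars data `F₀, F₂, r` (`lowerMargins`, `upperMargins`), `δ < r`, `2δ ≤ r`, `δ` below the
separation of `(ab)` and `(cd)`.  Given the lower inclusion S4 and the upper exclusion S5 (abstract
block map; instantiated with `β p = blkUnit (p/δ)` through `stub_tiling`), the crude site crossing
probability of `R` at mesh `δ` is sandwiched between the leg probabilities of `R₁` and `R₂` at block
side `m(δ)`, nucleus scale `s(δ)`, up to the probability of the bad event of S6 on the window
`V = cthickening 1 (closure Ω ∪ closure R₁ ∪ closure R₂)`. [cite: BollobasRiordan2006, Ch. 7 Lemma 14 with (19)] -/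
theorem sandwich_at (hL : (∀ (R R₁ : ConformalRectangle) {δ : ℝ}, 0 < δ → ∀ (β : ℂ → (ℤ × ℤ) ⊕ (ℤ × ℤ)),
      (∀ p : ℂ, dist p ((δ : ℂ) * zGs (β p)) ≤ 3 / 5 * δ) →
      (∀ p q : ℂ, dist p q ≤ δ / 4 → β p = β q ∨ Gs.Adj (β p) (β q)) →
      ∀ (ω₂ : Set ((ℤ × ℤ) ⊕ (ℤ × ℤ))) (K V : Set ℂ),
      (∀ z ∈ V, ∃ p ∈ K, dist z p < δ / 16) → closure R₁.carrier ⊆ V →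
      {p | p ∈ K ∧ β p ∈ ω₂}.Nonempty →
      ∀ {F₀ F₂ : Set ℂ} {r : ℝ}, IsClosed F₀ → IsClosed F₂ → Disjoint F₀ F₂ →
      (∀ z ∈ F₀, r ≤ infDist z (R.arc 2)) → (∀ z ∈ F₂, r ≤ infDist z (R.arc 0)) →
      (∀ z, infDist z (closure R₁.carrier) ≤ r → r ≤ infDist z (R.arc 1) ∧ r ≤ infDist z (R.arc 3)) →
      (∀ z, infDist z (closure R₁.carrier) ≤ r → z ∉ closure R.carrier → z ∈ F₀ ∪ F₂) →
      (∀ z, infDist z (R₁.arc 0) ≤ r → z ∉ closure R.carrier ∧ z ∈ F₀) →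
      (∀ z, infDist z (R₁.arc 2) ≤ r → z ∉ closure R.carrier ∧ z ∈ F₂) →
      δ < r → (∀ z, infDist z (R.arc 0) ≤ δ → δ < infDist z (R.arc 2)) →
      ∀ {x y : ℂ} (γ : Path x y), x ∈ R₁.arc 0 → y ∈ R₁.arc 2 → (∀ t, γ t ∈ closure R₁.carrier) →
      (∀ t, γ t ∈ blackRegion {p | p ∈ K ∧ β p ∈ ω₂} {p | p ∈ K ∧ β p ∉ ω₂}) →
      ω₂ ∈ crudeCrossing R δ)) (hU : (∀ (R R₂ : ConformalRectangle) {δ : ℝ}, 0 < δ → ∀ (β : ℂ → (ℤ × ℤ) ⊕ (ℤ × ℤ)),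
      (∀ p : ℂ, dist p ((δ : ℂ) * zGs (β p)) ≤ 3 / 5 * δ) →
      (∀ p q : ℂ, dist p q ≤ δ / 4 → β p = β q ∨ Gs.Adj (β p) (β q)) →
      (∀ u v : (ℤ × ℤ) ⊕ (ℤ × ℤ), u = v ∨ Gs.Adj u v →
        ∀ z ∈ segment ℝ ((δ : ℂ) * zGs u) ((δ : ℂ) * zGs v), β z = u ∨ β z = v) →
      ∀ (ω₂ : Set ((ℤ × ℤ) ⊕ (ℤ × ℤ))) (K V : Set ℂ),
      (∀ z ∈ V, ∃ p ∈ K, dist z p < δ / 16) → closure R₂.carrier ⊆ V →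
      {p | p ∈ K ∧ β p ∉ ω₂}.Nonempty →
      ∀ {r : ℝ}, (∀ (p₁ p₃ q₀ q₂ : ℂ) (P : Path p₁ p₃) (Q : Path q₀ q₂),
        infDist p₁ (R₂.arc 0) ≤ r → infDist p₃ (R₂.arc 2) ≤ r →
        (∀ t, infDist (P t) (closure R₂.carrier) ≤ r) →
        infDist q₀ (R.arc 0) ≤ r → infDist q₂ (R.arc 2) ≤ r → (∀ s, infDist (Q s) R.carrier ≤ r) →
        ∃ t s, P t = Q s) →
      2 * δ ≤ r → ω₂ ∈ crudeCrossing R δ →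
      ∀ {p q : ℂ} (P₀ : Path p q), p ∈ R₂.arc 0 → q ∈ R₂.arc 2 → (∀ t, P₀ t ∈ closure R₂.carrier) →
      (∀ t, P₀ t ∈ blackRegion {p | p ∈ K ∧ β p ∉ ω₂} {p | p ∈ K ∧ β p ∈ ω₂}) →
      False))
    {P PK : Measure (PointConfig ℂ)} [IsProbabilityMeasure P] [IsProbabilityMeasure PK]
    (R R₁ R₂ : ConformalRectangle) {F₀ F₂ : Set ℂ} {r δ : ℝ}
    (hlow : r ∈ lowerMargins R R₁ F₀ F₂) (hup : r ∈ upperMargins R R₂)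
    (hδ : 0 < δ) (hδr : δ < r) (h2δr : 2 * δ ≤ r)
    (h02 : ∀ z : ℂ, infDist z (R.arc 0) ≤ δ → δ < infDist z (R.arc 2)) :
    legProb P P PK R₁ (mOf δ) (sOf δ) -
        (legMeasure P P PK).real {ω | ¬ ((ω.1.1.1 : Set ℂ) = ∅ ∧ (ω.1.1.2 : Set ℂ) = ∅ ∧
          (∀ z ∈ cthickening 1 (closure R.carrier ∪ closure R₁.carrier ∪ closure R₂.carrier),
            ∃ x ∈ (ω.1.2 : Set ℂ), dist z ((sOf δ : ℂ) * x) < δ / 16) ∧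
          (∃ x ∈ (ω.1.2 : Set ℂ), blk (mOf δ) x ∈ ω.2) ∧ (∃ x ∈ (ω.1.2 : Set ℂ), blk (mOf δ) x ∉ ω.2))} ≤
      siteCrossingProb R δ ∧
    siteCrossingProb R δ ≤ 1 - legProb P P PK R₂ (mOf δ) (sOf δ) +
        (legMeasure P P PK).real {ω | ¬ ((ω.1.1.1 : Set ℂ) = ∅ ∧ (ω.1.1.2 : Set ℂ) = ∅ ∧
          (∀ z ∈ cthickening 1 (closure R.carrier ∪ closure R₁.carrier ∪ closure R₂.carrier),
            ∃ x ∈ (ω.1.2 : Set ℂ), dist z ((sOf δ : ℂ) * x) < δ / 16) ∧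
          (∃ x ∈ (ω.1.2 : Set ℂ), blk (mOf δ) x ∈ ω.2) ∧ (∃ x ∈ (ω.1.2 : Set ℂ), blk (mOf δ) x ∉ ω.2))} := by
  obtain ⟨-, hF₀c, hF₂c, hdisj, hA, hB, hC, hD, hE, hF⟩ := hlow
  obtain ⟨-, hcross⟩ := hup
  -- notation
  set m : ℝ := mOf δ with hm
  set s : ℝ := sOf δ with hs
  have hm0 : m ≠ 0 := (mOf_pos δ).ne'
  have hs0 : s ≠ 0 := (sOf_pos hδ).ne'
  have hsm : s * m = δ := sOf_mul_mOf δ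
  set μ : Measure LegConfig := legMeasure P P PK with hμ
  haveI : IsProbabilityMeasure μ := by
    rw [hμ, legMeasure]; infer_instance
  set V : Set ℂ := cthickening 1 (closure R.carrier ∪ closure R₁.carrier ∪ closure R₂.carrier) with hV
  have hR₁V : closure R₁.carrier ⊆ V :=
    (subset_union_right.trans subset_union_left).trans (self_subset_cthickening _)
  have hR₂V : closure R₂.carrier ⊆ V := subset_union_right.trans (self_subset_cthickening _)
  -- the block map and its three metric facts
  set β : ℂ → (ℤ × ℤ) ⊕ (ℤ × ℤ) := fun p => blkUnit (p / (δ : ℂ)) with hβ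
  obtain ⟨hrad, hsep, hspine⟩ := stub_tiling hδ
  -- the events
  set G : Set LegConfig := {ω | (ω.1.1.1 : Set ℂ) = ∅ ∧ (ω.1.1.2 : Set ℂ) = ∅ ∧
      (∀ z ∈ V, ∃ x ∈ (ω.1.2 : Set ℂ), dist z ((s : ℂ) * x) < δ / 16) ∧
      (∃ x ∈ (ω.1.2 : Set ℂ), blk m x ∈ ω.2) ∧ (∃ x ∈ (ω.1.2 : Set ℂ), blk m x ∉ ω.2)} with hG
  set C : Set LegConfig := {ω | ω.2 ∈ crudeCrossing R δ} with hCdef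
  have hCm : MeasurableSet C := measurable_snd (measurableSet_crudeCrossing R hδ)
  have hCsite : μ.real C = siteCrossingProb R δ := legMeasure_real_coins P P PK _
  have hbad : {ω : LegConfig | ¬ ((ω.1.1.1 : Set ℂ) = ∅ ∧ (ω.1.1.2 : Set ℂ) = ∅ ∧
      (∀ z ∈ V, ∃ x ∈ (ω.1.2 : Set ℂ), dist z ((s : ℂ) * x) < δ / 16) ∧
      (∃ x ∈ (ω.1.2 : Set ℂ), blk m x ∈ ω.2) ∧ (∃ x ∈ (ω.1.2 : Set ℂ), blk m x ∉ ω.2))} = Gᶜ := rfl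
  -- plane data of a good configuration
  have hgood : ∀ ω ∈ G,
      (∀ z ∈ V, ∃ p ∈ (s : ℂ) • (ω.1.2 : Set ℂ), dist z p < δ / 16) ∧
      {p | p ∈ (s : ℂ) • (ω.1.2 : Set ℂ) ∧ β p ∈ ω.2}.Nonempty ∧
      {p | p ∈ (s : ℂ) • (ω.1.2 : Set ℂ) ∧ β p ∉ ω.2}.Nonempty ∧
      (s : ℂ) • blackNuclei m ω = {p | p ∈ (s : ℂ) • (ω.1.2 : Set ℂ) ∧ β p ∈ ω.2} ∧
      (s : ℂ) • whiteNuclei m ω = {p | p ∈ (s : ℂ) • (ω.1.2 : Set ℂ) ∧ β p ∉ ω.2} := by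
    rintro ω ⟨h1, h2, h3, ⟨xb, hxb, hb⟩, ⟨xw, hxw, hw⟩⟩
    refine ⟨fun z hz => ?_, ⟨(s : ℂ) * xb, ⟨smul_mem_smul_set hxb, ?_⟩⟩,
      ⟨(s : ℂ) * xw, ⟨smul_mem_smul_set hxw, ?_⟩⟩,
      smul_blackNuclei_eq hs0 hm0 hsm h1, smul_whiteNuclei_eq hs0 hm0 hsm h2⟩
    · obtain ⟨x, hx, hd⟩ := h3 z hz
      exact ⟨(s : ℂ) * x, smul_mem_smul_set hx, hd⟩
    · show blkUnit ((s : ℂ) * xb / (δ : ℂ)) ∈ ω.2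
      rwa [blkUnit_smul_div hs0 hm0 hsm]
    · show blkUnit ((s : ℂ) * xw / (δ : ℂ)) ∉ ω.2
      rwa [blkUnit_smul_div hs0 hm0 hsm]
  constructor
  · -- LOWER: `legCrossing R₁ ⊆ C ∪ Gᶜ`
    have hincl : legCrossing R₁ m s ⊆ C ∪ Gᶜ := by
      intro ω hω
      by_cases hωG : ω ∈ G
      · left
        obtain ⟨hdense, hBne, -, hBeq, hWeq⟩ := hgood ω hωG
        obtain ⟨x, y, γ, hx, hy, hγ⟩ := exists_path_of_voronoiCrossing hs0 hω
        rw [hBeq, hWeq] at hγ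
        exact hL R R₁ hδ β hrad hsep ω.2 ((s : ℂ) • (ω.1.2 : Set ℂ)) V hdense hR₁V hBne hF₀c hF₂c
          hdisj hA hB hC hD hE hF hδr h02 γ hx hy (fun t => (hγ t).1) (fun t => (hγ t).2)
      · exact Or.inr hωG
    have h1 : legProb P P PK R₁ m s ≤ μ.real (C ∪ Gᶜ) := measureReal_mono hincl
    have h2 := measureReal_union_le (μ := μ) C Gᶜ
    rw [← hCsite, hbad]
    linarith
  · -- UPPER: `E₂ ∩ C ⊆ Gᶜ` for the white crossing event `E₂` of `R₂`
    set E₂ : Set LegConfig := {ω | voronoiCrossing R₂.carrier (R₂.arc 0) (R₂.arc 2) s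
      (whiteNuclei m ω) (blackNuclei m ω)} with hE₂
    have hwhite : μ.real E₂ = legProb P P PK R₂ m s := legMeasure_real_whiteCrossing P PK R₂ m s
    have hexcl : E₂ ∩ C ⊆ Gᶜ := by
      rintro ω ⟨hω, hωC⟩ hωG
      obtain ⟨hdense, -, hWne, hBeq, hWeq⟩ := hgood ω hωG
      obtain ⟨p, q, P₀, hp, hq, hP₀⟩ := exists_path_of_voronoiCrossing hs0 hω
      rw [hBeq, hWeq] at hP₀
      exact hU R R₂ hδ β hrad hsep hspine ω.2 ((s : ℂ) • (ω.1.2 : Set ℂ)) V hdense hR₂V hWne hcross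
        h2δr hωC P₀ hp hq (fun t => (hP₀ t).1) (fun t => (hP₀ t).2)
    have h1 : μ.real (E₂ ∩ C) + μ.real (E₂ \ C) = μ.real E₂ := measureReal_inter_add_sdiff hCm
    have h2 : μ.real (E₂ ∩ C) ≤ μ.real Gᶜ := measureReal_mono hexcl
    have h3 : μ.real (E₂ \ C) ≤ μ.real Cᶜ := measureReal_mono fun ω hω => hω.2
    have h4 : μ.real Cᶜ = 1 - μ.real C := probReal_compl_eq_one_sub hCm
    rw [← hCsite, hbad, ← hwhite]
    linarith

/-! ### The endpoint -/

/-- **S7 `stub_endpointSandwich_of` — THE CHESSBOARD ENDPOINT** (registered stub of line `Sketch`,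
crux stmt-CriticalPhenomena-6434): from the lower inclusion S4, the upper exclusion S5 and the density
estimate S6, Cardy's formula for the `u = 1` leg probabilities of every conformal rectangle implies
Cardy's formula for the crude site crossing of `G_s`.  The `u = 1` laws exist (Poisson processes of
intensities `0` and `2 · volume`, `existsUnique_isPoissonPointProcess_holds`); for `θ > 0`, K1's
`stub_perturbedRectangles` gives `R₁`, `R₂`; eventually the sandwich `sandwich_at` holds, the bad event
has probability `≤ θ`, and the leg probabilities of `R₁`, `R₂` are within `θ` of `F(η₁)`, `F(η₂)`,
themselves within `θ` of `F(η)`, `1 − F(η)`: so `|siteCrossingProb R δ − F(η)| ≤ 3θ` eventually.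
[cite: BollobasRiordan2006, Ch. 7 Lemma 14 with (19)] -/
theorem stub_endpointSandwich_of : (∀ (R R₁ : ConformalRectangle) {δ : ℝ}, 0 < δ → ∀ (β : ℂ → (ℤ × ℤ) ⊕ (ℤ × ℤ)),
      (∀ p : ℂ, dist p ((δ : ℂ) * zGs (β p)) ≤ 3 / 5 * δ) →
      (∀ p q : ℂ, dist p q ≤ δ / 4 → β p = β q ∨ Gs.Adj (β p) (β q)) →
      ∀ (ω₂ : Set ((ℤ × ℤ) ⊕ (ℤ × ℤ))) (K V : Set ℂ),
      (∀ z ∈ V, ∃ p ∈ K, dist z p < δ / 16) → closure R₁.carrier ⊆ V →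
      {p | p ∈ K ∧ β p ∈ ω₂}.Nonempty →
      ∀ {F₀ F₂ : Set ℂ} {r : ℝ}, IsClosed F₀ → IsClosed F₂ → Disjoint F₀ F₂ →
      (∀ z ∈ F₀, r ≤ infDist z (R.arc 2)) → (∀ z ∈ F₂, r ≤ infDist z (R.arc 0)) →
      (∀ z, infDist z (closure R₁.carrier) ≤ r → r ≤ infDist z (R.arc 1) ∧ r ≤ infDist z (R.arc 3)) →
      (∀ z, infDist z (closure R₁.carrier) ≤ r → z ∉ closure R.carrier → z ∈ F₀ ∪ F₂) →
      (∀ z, infDist z (R₁.arc 0) ≤ r → z ∉ closure R.carrier ∧ z ∈ F₀) →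
      (∀ z, infDist z (R₁.arc 2) ≤ r → z ∉ closure R.carrier ∧ z ∈ F₂) →
      δ < r → (∀ z, infDist z (R.arc 0) ≤ δ → δ < infDist z (R.arc 2)) →
      ∀ {x y : ℂ} (γ : Path x y), x ∈ R₁.arc 0 → y ∈ R₁.arc 2 → (∀ t, γ t ∈ closure R₁.carrier) →
      (∀ t, γ t ∈ blackRegion {p | p ∈ K ∧ β p ∈ ω₂} {p | p ∈ K ∧ β p ∉ ω₂}) →
      ω₂ ∈ crudeCrossing R δ) →
    (∀ (R R₂ : ConformalRectangle) {δ : ℝ}, 0 < δ → ∀ (β : ℂ → (ℤ × ℤ) ⊕ (ℤ × ℤ)),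
      (∀ p : ℂ, dist p ((δ : ℂ) * zGs (β p)) ≤ 3 / 5 * δ) →
      (∀ p q : ℂ, dist p q ≤ δ / 4 → β p = β q ∨ Gs.Adj (β p) (β q)) →
      (∀ u v : (ℤ × ℤ) ⊕ (ℤ × ℤ), u = v ∨ Gs.Adj u v →
        ∀ z ∈ segment ℝ ((δ : ℂ) * zGs u) ((δ : ℂ) * zGs v), β z = u ∨ β z = v) →
      ∀ (ω₂ : Set ((ℤ × ℤ) ⊕ (ℤ × ℤ))) (K V : Set ℂ),
      (∀ z ∈ V, ∃ p ∈ K, dist z p < δ / 16) → closure R₂.carrier ⊆ V →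
      {p | p ∈ K ∧ β p ∉ ω₂}.Nonempty →
      ∀ {r : ℝ}, (∀ (p₁ p₃ q₀ q₂ : ℂ) (P : Path p₁ p₃) (Q : Path q₀ q₂),
        infDist p₁ (R₂.arc 0) ≤ r → infDist p₃ (R₂.arc 2) ≤ r →
        (∀ t, infDist (P t) (closure R₂.carrier) ≤ r) →
        infDist q₀ (R.arc 0) ≤ r → infDist q₂ (R.arc 2) ≤ r → (∀ s, infDist (Q s) R.carrier ≤ r) →
        ∃ t s, P t = Q s) →
      2 * δ ≤ r → ω₂ ∈ crudeCrossing R δ →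
      ∀ {p q : ℂ} (P₀ : Path p q), p ∈ R₂.arc 0 → q ∈ R₂.arc 2 → (∀ t, P₀ t ∈ closure R₂.carrier) →
      (∀ t, P₀ t ∈ blackRegion {p | p ∈ K ∧ β p ∉ ω₂} {p | p ∈ K ∧ β p ∈ ω₂}) →
      False) →
    (∀ (PBf PWf PK : Measure (PointConfig ℂ)),
      IsPoissonPointProcess (0 : Measure ℂ) PBf → IsPoissonPointProcess (0 : Measure ℂ) PWf →
      IsPoissonPointProcess ((2 : ENNReal) • (volume : Measure ℂ)) PK →
      ∀ V : Set ℂ, Bornology.IsBounded V → (interior V).Nonempty →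
      Tendsto (fun δ : ℝ => (legMeasure PBf PWf PK).real {ω | ¬ ((ω.1.1.1 : Set ℂ) = ∅ ∧ (ω.1.1.2 : Set ℂ) = ∅ ∧
          (∀ z ∈ V, ∃ x ∈ (ω.1.2 : Set ℂ), dist z ((sOf δ : ℂ) * x) < δ / 16) ∧
          (∃ x ∈ (ω.1.2 : Set ℂ), blk (mOf δ) x ∈ ω.2) ∧ (∃ x ∈ (ω.1.2 : Set ℂ), blk (mOf δ) x ∉ ω.2))})
        (𝓝[>] 0) (𝓝 0)) →
    (∀ (PBf PWf PK : Measure (PointConfig ℂ)),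
      IsPoissonPointProcess (0 : Measure ℂ) PBf → IsPoissonPointProcess (0 : Measure ℂ) PWf →
      IsPoissonPointProcess ((2 : ENNReal) • (volume : Measure ℂ)) PK →
      ∀ R : ConformalRectangle,
        R.HasCrossingLimit (fun δ => legProb PBf PWf PK R (mOf δ) (sOf δ)) cardyFunction) →
    ∀ R : ConformalRectangle, R.HasCrossingLimit (siteCrossingProb R) cardyFunction := by
  intro hL hU hD hEnd R φ x hux
  -- the `u = 1` laws
  obtain ⟨P, hP, -⟩ :=
    Literature.Analysis.FunctionSpaces.existsUnique_isPoissonPointProcess_holds (E := ℂ)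
      (0 : Measure ℂ) (fun z => by simp)
  have h2 : ((2 : NNReal) • (volume : Measure ℂ)) = (2 : ENNReal) • (volume : Measure ℂ) := rfl
  haveI : IsLocallyFiniteMeasure ((2 : ENNReal) • (volume : Measure ℂ)) := by
    rw [← h2]; infer_instance
  obtain ⟨PK, hPK, -⟩ :=
    Literature.Analysis.FunctionSpaces.existsUnique_isPoissonPointProcess_holds (E := ℂ)
      ((2 : ENNReal) • (volume : Measure ℂ)) (fun z => by simp)
  haveI := hP.isProbabilityMeasure
  haveI := hPK.isProbabilityMeasure
  rw [Metric.tendsto_nhds]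
  intro ε hε
  have hθ : 0 < ε / 4 := by positivity
  obtain ⟨R₁, R₂, φ₁, x₁, φ₂, x₂, F₀, F₂, r, hx₁, hx₂, hCardy, hlow, hup⟩ :=
    stub_perturbedRectangles R (ε / 4) hθ
  obtain ⟨hc₁, hc₂⟩ := hCardy φ x hux
  have hr0 : 0 < r := hlow.1
  -- the window of S6
  set V : Set ℂ := cthickening 1 (closure R.carrier ∪ closure R₁.carrier ∪ closure R₂.carrier) with hV
  have hVb : Bornology.IsBounded V :=
    ((R.isBounded.closure.union R₁.isBounded.closure).union R₂.isBounded.closure).cthickening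
  have hVi : (interior V).Nonempty := by
    obtain ⟨z, hz⟩ := R.nonempty
    have hRV : R.carrier ⊆ V := subset_closure.trans
      ((subset_union_left.trans subset_union_left).trans (self_subset_cthickening _))
    exact ⟨z, (R.isOpen.subset_interior_iff.2 hRV) hz⟩
  -- the five eventualities
  have hev1 : ∀ᶠ δ in 𝓝[>] (0 : ℝ), δ < r ∧ 2 * δ ≤ r := by
    filter_upwards [Ioo_mem_nhdsGT (show (0 : ℝ) < r / 2 by positivity)] with δ hδ
    exact ⟨by linarith [hδ.2], by linarith [hδ.2]⟩
  have hev2 := eventually_lt_infDist_arc_two R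
  have hev3 : ∀ᶠ δ in 𝓝[>] (0 : ℝ), (legMeasure P P PK).real {ω | ¬ ((ω.1.1.1 : Set ℂ) = ∅ ∧
      (ω.1.1.2 : Set ℂ) = ∅ ∧ (∀ z ∈ V, ∃ x ∈ (ω.1.2 : Set ℂ), dist z ((sOf δ : ℂ) * x) < δ / 16) ∧
      (∃ x ∈ (ω.1.2 : Set ℂ), blk (mOf δ) x ∈ ω.2) ∧ (∃ x ∈ (ω.1.2 : Set ℂ), blk (mOf δ) x ∉ ω.2))} ≤
      ε / 4 :=
    (hD P P PK hP hP hPK V hVb hVi).eventually_le_const hθ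
  have hev4 : ∀ᶠ δ in 𝓝[>] (0 : ℝ),
      cardyFunction (crossRatio x₁) - ε / 4 < legProb P P PK R₁ (mOf δ) (sOf δ) :=
    (hEnd P P PK hP hP hPK R₁ φ₁ x₁ hx₁).eventually (Ioi_mem_nhds (by linarith))
  have hev5 : ∀ᶠ δ in 𝓝[>] (0 : ℝ),
      cardyFunction (crossRatio x₂) - ε / 4 < legProb P P PK R₂ (mOf δ) (sOf δ) :=
    (hEnd P P PK hP hP hPK R₂ φ₂ x₂ hx₂).eventually (Ioi_mem_nhds (by linarith))
  filter_upwards [hev1, hev2, hev3, hev4, hev5, self_mem_nhdsWithin] with δ hδ1 hδ2 hδ3 hδ4 hδ5 hδ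
  obtain ⟨hlo, hhi⟩ := sandwich_at hL hU (P := P) (PK := PK) R R₁ R₂ hlow hup hδ hδ1.1 hδ1.2 hδ2
  rw [Real.dist_eq, abs_lt]
  have ha₁ := abs_le.1 hc₁
  have ha₂ := abs_le.1 hc₂
  constructor <;> linarith

end Summit.CriticalPhenomena.CardyFormulaZ2.Cruxes.SquareFromVoronoiHub.PoissonisedChessboard

end
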